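import Summits.AtomisticToContinuum.Crystallization.Theses.FluxTubeKepler

/-!
# `FluxCellKepler` (stmt-AtomisticToContinuum-15221), line `Sketch` — helper I: the energy identity

The Lennard-Jones energy of a finite configuration in the cell-functional normalisation of the crux
`FluxTubeKepler.FluxCellKepler`:
`E_LJ(x) = Σ_i ((1/24) site₁₂(x)_i − (1/12) site₆(x)_i)`,
from double counting (`two_mul_interactionEnergy`) and `V_LJ(r) = (1/12) r⁻¹² − (1/6) r⁻⁶`.
It certifies the pairing of the constants `1/24, 1/12` in the crux with the tree's normalisation and
is the assembly lemma of the line's skeleton (`Cruxes/FluxCellKepler/Lines/Sketch.lean`).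
-/

namespace Summit.AtomisticToContinuum.Crystallization.Theorems.FluxCellKeplerSketch

open scoped BigOperators
open Literature.MathematicalPhysics.StatisticalMechanics

/-- Site energies split linearly in the potential: `siteEnergy (a•V + b•W) = a siteEnergy V + b siteEnergy W`
for the Lennard-Jones combination. [folklore] -/
theorem siteEnergy_lennardJones_eq {d N : ℕ} (x : Fin N → EuclideanSpace ℝ (Fin d)) (i : Fin N) :
    siteEnergy lennardJones x i
      = (1 / 12 : ℝ) * siteEnergy (fun r => (r⁻¹) ^ 12) x i
          - (1 / 6 : ℝ) * siteEnergy (fun r => (r⁻¹) ^ 6) x i := by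
  simp only [siteEnergy, lennardJones, Finset.sum_sub_distrib, Finset.mul_sum]

/-- **Energy identity.** `E_LJ(x) = Σ_i ((1/24) site₁₂(x)_i − (1/12) site₆(x)_i)` for every finite
configuration in any dimension: double counting (`two_mul_interactionEnergy`) and
`V_LJ(r) = (1/12) r⁻¹² − (1/6) r⁻⁶`. [folklore] -/
theorem interactionEnergy_lennardJones_eq_sum {d N : ℕ} (x : Fin N → EuclideanSpace ℝ (Fin d)) :
    interactionEnergy lennardJones x
      = ∑ i, ((1 / 24 : ℝ) * siteEnergy (fun r => (r⁻¹) ^ 12) x i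
          - (1 / 12 : ℝ) * siteEnergy (fun r => (r⁻¹) ^ 6) x i) := by
  have h2 := two_mul_interactionEnergy lennardJones x
  rw [Finset.sum_congr rfl fun i _ => siteEnergy_lennardJones_eq x i] at h2
  have hE : interactionEnergy lennardJones x
      = (1 / 2 : ℝ) * ∑ i, ((1 / 12 : ℝ) * siteEnergy (fun r => (r⁻¹) ^ 12) x i
          - (1 / 6 : ℝ) * siteEnergy (fun r => (r⁻¹) ^ 6) x i) := by
    linarith
  rw [hE, Finset.mul_sum]
  exact Finset.sum_congr rfl fun i _ => by ring

/-- The cell-functional form used by KEPLER: for any real `τ_i`,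
`Σ_i ((1/24) site₁₂ − (1/12) τ_i) = E_LJ(x) − (1/12)(Σ_i τ_i − Σ_i site₆)`. [folklore] -/
theorem sum_cellScore_eq {d N : ℕ} (x : Fin N → EuclideanSpace ℝ (Fin d)) (t : Fin N → ℝ) :
    ∑ i, ((1 / 24 : ℝ) * siteEnergy (fun r => (r⁻¹) ^ 12) x i - (1 / 12 : ℝ) * t i)
      = interactionEnergy lennardJones x
          - (1 / 12 : ℝ) * (∑ i, t i - ∑ i, siteEnergy (fun r => (r⁻¹) ^ 6) x i) := by
  rw [interactionEnergy_lennardJones_eq_sum, Finset.sum_sub_distrib, Finset.sum_sub_distrib,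
    ← Finset.mul_sum, ← Finset.mul_sum, ← Finset.mul_sum]
  ring

/-- **Energy identity, registered closed form** (stub `stub_energyIdentity` of the crux item):
`E_LJ(x) = Σ_i ((1/24) site₁₂(x)_i − (1/12) site₆(x)_i)` in every dimension. [folklore] -/
theorem stub_energyIdentity : ∀ {d N : ℕ} (x : Fin N → EuclideanSpace ℝ (Fin d)), interactionEnergy lennardJones x = ∑ i, ((1 / 24 : ℝ) * siteEnergy (fun r => (r⁻¹) ^ 12) x i - (1 / 12 : ℝ) * siteEnergy (fun r => (r⁻¹) ^ 6) x i) :=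
  fun x => interactionEnergy_lennardJones_eq_sum x

end Summit.AtomisticToContinuum.Crystallization.Theorems.FluxCellKeplerSketch
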